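import Mathlib
import Summits.ResolutionOfSingularities.ResolutionOfSingularities.Theorems.WeightedInvariantLocalWeightedDropWildMonicSCleanShift

/-!
# `WeightedInvariant.LocalWeightedDrop`, line `hasse-ridge-face-selection`, S3ρ sub-stub S3ρD `stub_wildMonicSurfaceDescent`:
# SECONDARY CLEANNESS IS MAXIMALITY OF `s` — Perlega Proposition 5.2.5 for monic tuples

Crux item stmt-ResolutionOfSingularities-8899 `LocalWeightedDrop` (route `ResolutionOfSingularities/WeightedInvariant`), engine of
the door `HypersurfaceCentreConstruction` stmt-ResolutionOfSingularities-19897.  [OURS · L1 W4.3, chain w43, res-L1-w43-stub-7 (second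
seat on S3ρ under res-type-083); item (C4c) of `L/res-L1-w43-stub-7/S3RHOD-ROADMAP.md` (spec `…/S3RHOD-SPEC-C4.md`).  MODEL: S. Perlega,
thesis Wien 2017 / arXiv:2011.14443, Ch. 5 §2 Proposition 5.2.5 (s_cleaning_maximizes_slope) «Let `f ∈ J` be secondary `ord`-clean with
respect to `J_{-2}`. Then `ord J̃_{-2} ≤ ord J_{-2}`» for every `z ↦ z + g(x,y)` preserving the setting.  Nothing here is a statement of
H. Hironaka's manuscript [claim: Hironaka2017, status: under-review]; OUR objects and OUR proof.]

OUR PROOF (different from Perlega's coefficient chase, same statement).  Let `s = sFlag E N < ⊤`, `δ = dRes`, `r = excExp`, `q = p^{v_p d}`,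
and let `m₁` be the least row `Q₁` of a reduced scaled point ON the `s`-line (`exists_min_onSLine_row`).  For the PERTURBED LINE WEIGHT
`w′ = (δ·δ!, δ·s + 1)` one has `w′(Q) = δ·(δ!Q₀ + sQ₁) + Q₁`, so (all points being on or above the `s`-line, integrally)
`m_{w′}(A) = δ·sδ + m₁ + w′(r)` and a monomial attains it iff its reduced point is ON the `s`-line in the row `m₁`
(`wMin_lineWeight_eq`, `slotWOrd_lineWeight_eq_wMin_iff`).  Reading Perlega's `(i)_b ∨ (ii)_b ∨ (iii)_b` at the index `b` of that row
(`d!·b = m₁ + r₁` when the slot `d − q` attains) gives EXACTLY the `w′`-cleanness `(1)_{w′} ∨ (2)_{w′} ∨ (3)_{w′}` of `…WildMonicWClean`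
(`isWClean_lineWeight_of_isSClean`).  If a setting-preserving re-centring had `sFlag(shift d A g) ≥ s + 1`, every reduced point `Q` of the
new tuple would satisfy `δ!Q₀ + sQ₁ ≥ sδ + (δ − Q₁)`, whence `m_{w′}(shift d A g) ≥ δ·sδ + δ + w′(r) > m_{w′}(A)` — contradicting
PROPOSITION 5.1.3 (`wMin_shift_le_of_isWClean`, p504433) for the weight `w′`.  Hence `sFlag_shift_le_of_isSClean`.
-/

set_option linter.dupNamespace false -- mandated namespace of this single-conjunct summit

noncomputable section

namespace Summit.ResolutionOfSingularities.ResolutionOfSingularities.Theorems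

namespace WildMonic

open MvPowerSeries MonicDescent

variable {k : Type} [Field k] {d : ℕ}

/-- The perturbed line weight evaluates as `w′(Q) = δ·(δ!·Q₀ + s·Q₁) + Q₁`. -/
theorem weight_lineWeight (δ s : ℕ) (Q : Fin 2 →₀ ℕ) :
    Finsupp.weight ![δ * δ.factorial, δ * s + 1] Q = δ * (δ.factorial * Q 0 + s * Q 1) + Q 1 := by
  rw [Literature.AlgebraicGeometry.Resolution.WeightedShear.weight_fin_two]; ring

/-- A point on the `s`-line cannot be strictly above it. -/
theorem not_aboveSLine_of_onSLine {δ : ℕ} {s : ℕ∞} {P : Fin 2 →₀ ℕ} (hon : OnSLine δ s P) : ¬ AboveSLine δ s P :=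
  fun h => absurd (h hon.1) (by rw [hon.2]; exact lt_irrefl _)

section Line

variable (E : Finset (Fin 2)) (A : Fin d → MvPowerSeries (Fin 2) k)

/-- For a finite `s = sFlag` there is a LEAST ROW `m₁` among the reduced scaled points on the `s`-line. -/
theorem exists_min_onSLine_row {s : ℕ} (hs : sFlag E (newtonSet A) = s) :
    ∃ m₁ : ℕ, (∃ (i : Fin d) (e : Fin 2 →₀ ℕ), coeff e (A i) ≠ 0 ∧ OnSLine (dRes E (newtonSet A)) (s : ℕ∞) (redPt A E i e) ∧
        redPt A E i e 1 = m₁) ∧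
      ∀ (i : Fin d) (e : Fin 2 →₀ ℕ), coeff e (A i) ≠ 0 → OnSLine (dRes E (newtonSet A)) (s : ℕ∞) (redPt A E i e) →
        m₁ ≤ redPt A E i e 1 := by
  classical
  obtain ⟨i, e, he, hon⟩ := exists_onSLine_of_sFlag_eq E A hs
  have hne : Set.Nonempty {m : ℕ | ∃ (i : Fin d) (e : Fin 2 →₀ ℕ), coeff e (A i) ≠ 0 ∧
      OnSLine (dRes E (newtonSet A)) (s : ℕ∞) (redPt A E i e) ∧ redPt A E i e 1 = m} := ⟨_, i, e, he, hon, rfl⟩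
  refine ⟨_, Nat.sInf_mem hne, fun i e he hon => ?_⟩
  have hm : redPt A E i e 1 ∈ {m : ℕ | ∃ (i : Fin d) (e : Fin 2 →₀ ℕ), coeff e (A i) ≠ 0 ∧
      OnSLine (dRes E (newtonSet A)) (s : ℕ∞) (redPt A E i e) ∧ redPt A E i e 1 = m} := ⟨i, e, he, hon, rfl⟩
  exact Nat.sInf_le hm

/-- ON the `s`-line the perturbed weight is `δ·sδ + Q₁`. -/
theorem weight_lineWeight_of_onSLine {δ s : ℕ} {Q : Fin 2 →₀ ℕ} (hon : OnSLine δ (s : ℕ∞) Q) :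
    Finsupp.weight ![δ * δ.factorial, δ * s + 1] Q = δ * (s * δ) + Q 1 := by
  rw [weight_lineWeight, (onSLine_natCast_iff.1 hon).2]

variable {s m₁ : ℕ} (hs : (s : ℕ∞) ≤ sFlag E (newtonSet A)) (hm : m₁ < dRes E (newtonSet A))
  (hmin : ∀ (i : Fin d) (e : Fin 2 →₀ ℕ), coeff e (A i) ≠ 0 → OnSLine (dRes E (newtonSet A)) (s : ℕ∞) (redPt A E i e) →
    m₁ ≤ redPt A E i e 1)

include hs hm hmin in
/-- THE LOWER BOUND `w′(Q) ≥ δ·sδ + m₁` at every monomial, WITH EQUALITY ONLY ON the `s`-line in the row `m₁`. -/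
theorem le_weight_lineWeight (i : Fin d) {e : Fin 2 →₀ ℕ} (he : coeff e (A i) ≠ 0) :
    dRes E (newtonSet A) * (s * dRes E (newtonSet A)) + m₁ ≤
        Finsupp.weight ![dRes E (newtonSet A) * (dRes E (newtonSet A)).factorial, dRes E (newtonSet A) * s + 1] (redPt A E i e) ∧
      (Finsupp.weight ![dRes E (newtonSet A) * (dRes E (newtonSet A)).factorial, dRes E (newtonSet A) * s + 1] (redPt A E i e) ≤
          dRes E (newtonSet A) * (s * dRes E (newtonSet A)) + m₁ →
        OnSLine (dRes E (newtonSet A)) (s : ℕ∞) (redPt A E i e) ∧ redPt A E i e 1 = m₁) := by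
  rw [weight_lineWeight]
  have hTL : s * dRes E (newtonSet A) ≤ (dRes E (newtonSet A)).factorial * redPt A E i e 0 + s * redPt A E i e 1 :=
    (natCast_le_sFlag_iff E A s).1 hs i e he
  have hδTL : dRes E (newtonSet A) * (s * dRes E (newtonSet A)) ≤
      dRes E (newtonSet A) * ((dRes E (newtonSet A)).factorial * redPt A E i e 0 + s * redPt A E i e 1) :=
    Nat.mul_le_mul_left _ hTL
  by_cases hon : OnSLine (dRes E (newtonSet A)) (s : ℕ∞) (redPt A E i e)
  · have h2 := (onSLine_natCast_iff.1 hon).2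
    have h3 := hmin i e he hon
    rw [h2]
    exact ⟨by omega, fun h => ⟨hon, by omega⟩⟩
  · by_cases h1 : redPt A E i e 1 < dRes E (newtonSet A)
    · have hne : (dRes E (newtonSet A)).factorial * redPt A E i e 0 + s * redPt A E i e 1 ≠ s * dRes E (newtonSet A) :=
        fun h => hon (onSLine_natCast_iff.2 ⟨h1, h⟩)
      have h4 : dRes E (newtonSet A) * (s * dRes E (newtonSet A) + 1) ≤
          dRes E (newtonSet A) * ((dRes E (newtonSet A)).factorial * redPt A E i e 0 + s * redPt A E i e 1) :=
        Nat.mul_le_mul_left _ (by omega)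
      rw [Nat.mul_succ] at h4
      exact ⟨by omega, fun h => absurd h (by omega)⟩
    · have h5 : s * dRes E (newtonSet A) ≤ s * redPt A E i e 1 := Nat.mul_le_mul_left s (not_lt.1 h1)
      exact ⟨by omega, fun h => absurd h (by omega)⟩

include hs hm hmin in
/-- HENCE `m_{w′}(A) = δ·sδ + m₁ + w′(r)`, given one monomial on the `s`-line in the row `m₁`. -/
theorem wMin_lineWeight_eq {i₀ : Fin d} {e₀ : Fin 2 →₀ ℕ} (he₀ : coeff e₀ (A i₀) ≠ 0)
    (hon₀ : OnSLine (dRes E (newtonSet A)) (s : ℕ∞) (redPt A E i₀ e₀)) (hrow₀ : redPt A E i₀ e₀ 1 = m₁) :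
    wMin ![dRes E (newtonSet A) * (dRes E (newtonSet A)).factorial, dRes E (newtonSet A) * s + 1] A =
      ((dRes E (newtonSet A) * (s * dRes E (newtonSet A)) + m₁ +
        Finsupp.weight ![dRes E (newtonSet A) * (dRes E (newtonSet A)).factorial, dRes E (newtonSet A) * s + 1]
          (excExp E (newtonSet A)) : ℕ) : ℕ∞) := by
  apply le_antisymm
  · refine le_trans (wMin_le_slotWOrd _ A i₀) (le_trans ((le_slotWOrd_iff A _ i₀).1 le_rfl e₀ he₀) (le_of_eq ?_))
    rw [slotWeight_mul_weight E A _ i₀ he₀, weight_lineWeight_of_onSLine hon₀, hrow₀]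
  · refine (le_wMin_iff_redPt E A _).2 fun i e he => ?_
    exact_mod_cast Nat.add_le_add_right (le_weight_lineWeight E A hs hm hmin i he).1 _

include hs hm hmin in
/-- A SLOT ATTAINS `m_{w′}` IFF it has a monomial ON the `s`-line in the row `m₁`. -/
theorem slotWOrd_lineWeight_eq_wMin_iff {i₀ : Fin d} {e₀ : Fin 2 →₀ ℕ} (he₀ : coeff e₀ (A i₀) ≠ 0)
    (hon₀ : OnSLine (dRes E (newtonSet A)) (s : ℕ∞) (redPt A E i₀ e₀)) (hrow₀ : redPt A E i₀ e₀ 1 = m₁) (i : Fin d) :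
    slotWOrd ![dRes E (newtonSet A) * (dRes E (newtonSet A)).factorial, dRes E (newtonSet A) * s + 1] A i =
        wMin ![dRes E (newtonSet A) * (dRes E (newtonSet A)).factorial, dRes E (newtonSet A) * s + 1] A ↔
      ∃ e : Fin 2 →₀ ℕ, coeff e (A i) ≠ 0 ∧ OnSLine (dRes E (newtonSet A)) (s : ℕ∞) (redPt A E i e) ∧ redPt A E i e 1 = m₁ := by
  have hW := wMin_lineWeight_eq E A hs hm hmin he₀ hon₀ hrow₀
  constructor
  · intro h
    have hne : A i ≠ 0 := by
      intro h0
      have htop : slotWOrd ![dRes E (newtonSet A) * (dRes E (newtonSet A)).factorial, dRes E (newtonSet A) * s + 1] A i = ⊤ := by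
        unfold slotWOrd; rw [h0, weightedOrder_zero, ENat.mul_top (by exact_mod_cast (slotWeight_pos i).ne')]
      rw [htop, hW] at h
      exact ENat.coe_ne_top _ h.symm
    obtain ⟨e, he, hwe⟩ := exists_coeff_ne_zero_and_weightedOrder
      ![dRes E (newtonSet A) * (dRes E (newtonSet A)).factorial, dRes E (newtonSet A) * s + 1] (f := A i)
      (ENat.coe_toNat (by rwa [Ne, weightedOrder_eq_top_iff]))
    have hval : ((slotWeight d i *
        Finsupp.weight ![dRes E (newtonSet A) * (dRes E (newtonSet A)).factorial, dRes E (newtonSet A) * s + 1] e : ℕ) : ℕ∞) =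
        wMin ![dRes E (newtonSet A) * (dRes E (newtonSet A)).factorial, dRes E (newtonSet A) * s + 1] A := by
      rw [← h]; unfold slotWOrd; rw [← hwe]; push_cast; rfl
    rw [hW, Nat.cast_inj, slotWeight_mul_weight E A _ i he, Nat.add_right_cancel_iff] at hval
    exact ⟨e, he, (le_weight_lineWeight E A hs hm hmin i he).2 hval.le⟩
  · rintro ⟨e, he, hon, hrow⟩
    refine le_antisymm (le_trans ((le_slotWOrd_iff A _ i).1 le_rfl e he) (le_of_eq ?_)) (wMin_le_slotWOrd _ A i)
    rw [hW, slotWeight_mul_weight E A _ i he, weight_lineWeight_of_onSLine hon, hrow]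

include hs hm hmin in
/-- Such an attaining monomial lies in the `w′`-INITIAL part of its slot. -/
theorem mem_initSupp_lineWeight {i₀ : Fin d} {e₀ : Fin 2 →₀ ℕ} (he₀ : coeff e₀ (A i₀) ≠ 0)
    (hon₀ : OnSLine (dRes E (newtonSet A)) (s : ℕ∞) (redPt A E i₀ e₀)) (hrow₀ : redPt A E i₀ e₀ 1 = m₁)
    {i : Fin d} {e : Fin 2 →₀ ℕ} (he : coeff e (A i) ≠ 0)
    (hon : OnSLine (dRes E (newtonSet A)) (s : ℕ∞) (redPt A E i e)) (hrow : redPt A E i e 1 = m₁) :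
    e ∈ initSupp ![dRes E (newtonSet A) * (dRes E (newtonSet A)).factorial, dRes E (newtonSet A) * s + 1] (A i) := by
  have hW := wMin_lineWeight_eq E A hs hm hmin he₀ hon₀ hrow₀
  refine ⟨he, le_antisymm ?_ (weightedOrder_le _ he)⟩
  by_contra hlt
  rw [not_le] at hlt
  have h1 := natCast_mul_lt_natCast_mul (slotWeight_pos i).ne' hlt
  have h2 := wMin_le_slotWOrd ![dRes E (newtonSet A) * (dRes E (newtonSet A)).factorial, dRes E (newtonSet A) * s + 1] A i
  unfold slotWOrd at h2
  have h3 : ((slotWeight d i *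
      Finsupp.weight ![dRes E (newtonSet A) * (dRes E (newtonSet A)).factorial, dRes E (newtonSet A) * s + 1] e : ℕ) : ℕ∞) =
      wMin ![dRes E (newtonSet A) * (dRes E (newtonSet A)).factorial, dRes E (newtonSet A) * s + 1] A := by
    rw [hW, slotWeight_mul_weight E A _ i he, weight_lineWeight_of_onSLine hon, hrow]
  rw [← h3] at h2
  push_cast at h2
  exact absurd (lt_of_le_of_lt h2 h1) (lt_irrefl _)

end Line

/-! ## Secondary cleanness is `w′`-cleanness; Proposition 5.2.5 -/

section Max

variable (p : ℕ) (E : Finset (Fin 2)) (A : Fin d → MvPowerSeries (Fin 2) k)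

/-- Coordinates of reduced points, with the exceptional exponent below the scaled exponent. -/
theorem redPt_apply_and_le (i : Fin d) {e : Fin 2 →₀ ℕ} (he : coeff e (A i) ≠ 0) (l : Fin 2) :
    redPt A E i e l = slotWeight d i * e l - excExp E (newtonSet A) l ∧ excExp E (newtonSet A) l ≤ slotWeight d i * e l := by
  refine ⟨redPt_apply A E i e l, ?_⟩
  have h := excExp_le (E := E) (smul_mem_newtonSet A i he) l
  simpa only [Finsupp.smul_apply, smul_eq_mul] using h

/-- SECONDARY `ord`-CLEANNESS IMPLIES `w′`-CLEANNESS for the perturbed line weight `w′ = (δ·δ!, δ·s + 1)` (`s = sFlag < ⊤`). -/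
theorem isWClean_lineWeight_of_isSClean {s : ℕ} (hs : sFlag E (newtonSet A) = s) (hclean : IsSClean p E A) :
    IsWClean p ![dRes E (newtonSet A) * (dRes E (newtonSet A)).factorial, dRes E (newtonSet A) * s + 1] A := by
  obtain ⟨m₁, ⟨i₀, e₀, he₀, hon₀, hrow₀⟩, hmin⟩ := exists_min_onSLine_row E A hs
  have hm : m₁ < dRes E (newtonSet A) := hrow₀ ▸ hon₀.1
  have hs' : (s : ℕ∞) ≤ sFlag E (newtonSet A) := hs.ge
  have hatt := slotWOrd_lineWeight_eq_wMin_iff E A hs' hm hmin he₀ hon₀ hrow₀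
  have hinit := fun (i : Fin d) (e : Fin 2 →₀ ℕ) (he : coeff e (A i) ≠ 0)
      (hon : OnSLine (dRes E (newtonSet A)) (s : ℕ∞) (redPt A E i e)) (hrow : redPt A E i e 1 = m₁) =>
    mem_initSupp_lineWeight E A hs' hm hmin he₀ hon₀ hrow₀ he hon hrow
  by_cases hB : ∃ (i : Fin d) (e : Fin 2 →₀ ℕ), (i : ℕ) = d - qOf p d ∧ coeff e (A i) ≠ 0 ∧
      OnSLine (dRes E (newtonSet A)) (s : ℕ∞) (redPt A E i e) ∧ redPt A E i e 1 = m₁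
  · obtain ⟨iq, e, hiq, he, hon, hrow⟩ := hB
    have hqd : qOf p d ≤ d := Nat.le_of_dvd (Fin.pos iq) (qOf_dvd p d)
    have hNq : slotWeight d iq * qOf p d = d.factorial := by
      have h := slotWeight_mul_sub iq
      rwa [show d - (iq : ℕ) = qOf p d by omega] at h
    by_cases hdvd : qOf p d ∣ e 1
    · obtain ⟨b, hb⟩ := hdvd
      have hdb : slotWeight d iq * e 1 = d.factorial * b := by rw [hb, ← mul_assoc, hNq]
      have hq1 := redPt_apply_and_le E A iq he 1
      rw [hrow, hdb] at hq1
      have hrange : d.factorial * b < dRes E (newtonSet A) + excExp E (newtonSet A) 1 := by omega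
      have hcase := hclean b hrange
      rw [hs] at hcase
      rcases hcase with h1 | h2 | h3
      · -- `(i)_b`: a later slot attains `m_{w′}` — `(1)_{w′}`
        obtain ⟨i', e', hi', he', hj', hon'⟩ := h1
        refine Or.inl ⟨i', hi', (hatt i').2 ⟨e', he', hon', le_antisymm ?_ (hmin i' e' he' hon')⟩⟩
        have h4 : slotWeight d i' * e' 1 ≤ slotWeight d i' * ((d - (i' : ℕ)) * b) := Nat.mul_le_mul_left _ hj'
        rw [← mul_assoc, slotWeight_mul_sub i'] at h4
        have h5 := redPt_apply_and_le E A i' he' 1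
        omega
      · -- `(ii)_b` contradicts the on-line monomial of the row `b·q`
        exact absurd (h2 iq e hiq he (by rw [hb, mul_comm])) (not_aboveSLine_of_onSLine hon)
      · -- `(iii)_b`: the least exponent of the row is `e 0` — `(3)_{w′}`
        obtain ⟨i', a, hi', hrowmin, hnd⟩ := h3
        have hii : i' = iq := Fin.ext (by rw [hi', hiq])
        subst hii
        have hba : b * qOf p d = e 1 := by rw [hb, mul_comm]
        have hea : a = e 0 := by
          rcases lt_trichotomy (e 0) a with hlt | heq | hgt
          · exfalso
            have h0 := hrowmin.2 (e 0) hlt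
            have hE : Finsupp.single 0 (e 0) + Finsupp.single 1 (e 1) = e := by
              ext l; fin_cases l <;> simp
            rw [hba, hE] at h0
            exact he h0
          · exact heq.symm
          · exfalso
            have hea' := hrowmin.1
            rw [hba] at hea'
            have he'0 : (Finsupp.single 0 a + Finsupp.single 1 (e 1) : Fin 2 →₀ ℕ) 0 = a := by simp
            have he'1 : (Finsupp.single 0 a + Finsupp.single 1 (e 1) : Fin 2 →₀ ℕ) 1 = e 1 := by simp
            have hline := (natCast_le_sFlag_iff E A s).1 hs' i' _ hea'
            have honeq := (onSLine_natCast_iff.1 hon).2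
            have h6 := redPt_apply_and_le E A i' hea' 0
            have h7 := redPt_apply_and_le E A i' he 0
            have h8 := redPt_apply_and_le E A i' hea' 1
            have h9 := redPt_apply_and_le E A i' he 1
            rw [he'0] at h6
            rw [he'1] at h8
            have h10 : slotWeight d i' * a < slotWeight d i' * e 0 := Nat.mul_lt_mul_of_pos_left hgt (slotWeight_pos i')
            have h11 : redPt A E i' (Finsupp.single 0 a + Finsupp.single 1 (e 1)) 0 < redPt A E i' e 0 := by omega
            have h12 : redPt A E i' (Finsupp.single 0 a + Finsupp.single 1 (e 1)) 1 = redPt A E i' e 1 := by omega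
            have h13 := Nat.mul_lt_mul_of_pos_left h11 (Nat.factorial_pos (dRes E (newtonSet A)))
            rw [h12] at hline
            omega
        subst hea
        exact Or.inr (Or.inr ⟨i', e, hi', hinit i' e he hon hrow, fun h => hnd h.1⟩)
    · exact Or.inr (Or.inr ⟨iq, e, hiq, hinit iq e he hon hrow, fun h => hdvd h.2⟩)
  · -- `(2)_{w′}`: the slot `d − q` does not attain
    refine Or.inr (Or.inl fun i hi => lt_of_le_of_ne (wMin_le_slotWOrd _ A i) fun heq => hB ?_)
    obtain ⟨e, he, hon, hrow⟩ := (hatt i).1 heq.symm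
    exact ⟨i, e, hi, he, hon, hrow⟩

variable [Fact p.Prime] [CharP k p]

/-- PERLEGA PROPOSITION 5.2.5 (s_cleaning_maximizes_slope) for monic tuples: at a SECONDARY `ord`-CLEAN position with finite `s = sFlag`,
NO re-centring `shift d A g` preserving the setting `(δ, r)` increases `s`. -/
theorem sFlag_shift_le_of_isSClean (E' : Finset (Fin 2)) (g : MvPowerSeries (Fin 2) k) {s : ℕ}
    (hs : sFlag E (newtonSet A) = s) (hclean : IsSClean p E A)
    (hδ : dRes E' (newtonSet (shift d A g)) = dRes E (newtonSet A))
    (hr : excExp E' (newtonSet (shift d A g)) = excExp E (newtonSet A)) :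
    sFlag E' (newtonSet (shift d A g)) ≤ s := by
  obtain ⟨m₁, ⟨i₀, e₀, he₀, hon₀, hrow₀⟩, hmin⟩ := exists_min_onSLine_row E A hs
  have hm : m₁ < dRes E (newtonSet A) := hrow₀ ▸ hon₀.1
  have hs' : (s : ℕ∞) ≤ sFlag E (newtonSet A) := hs.ge
  have hW := wMin_lineWeight_eq E A hs' hm hmin he₀ hon₀ hrow₀
  have h513 := wMin_shift_le_of_isWClean (p := p)
    (w := ![dRes E (newtonSet A) * (dRes E (newtonSet A)).factorial, dRes E (newtonSet A) * s + 1]) (A := A) (g := g)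
    (isWClean_lineWeight_of_isSClean p E A hs hclean) (by rw [hW]; exact ENat.coe_ne_top _)
  by_contra hlt
  rw [not_le] at hlt
  have hs1 : ((s + 1 : ℕ) : ℕ∞) ≤ sFlag E' (newtonSet (shift d A g)) := by push_cast; exact Order.add_one_le_of_lt hlt
  -- every reduced point of the new tuple lies on or above the `(s+1)`-line, hence `m_{w′}(shift) ≥ δ·sδ + δ + w′(r)`
  have hB : ((dRes E (newtonSet A) * (s * dRes E (newtonSet A)) + dRes E (newtonSet A) +
      Finsupp.weight ![dRes E (newtonSet A) * (dRes E (newtonSet A)).factorial, dRes E (newtonSet A) * s + 1]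
        (excExp E (newtonSet A)) : ℕ) : ℕ∞) ≤
      wMin ![dRes E (newtonSet A) * (dRes E (newtonSet A)).factorial, dRes E (newtonSet A) * s + 1] (shift d A g) := by
    refine (le_wMin_iff_redPt E' (shift d A g) _).2 fun i e he => ?_
    rw [hr, Nat.cast_le, add_le_add_iff_right, weight_lineWeight]
    have hline := (natCast_le_sFlag_iff E' (shift d A g) (s + 1)).1 hs1 i e he
    rw [hδ, Nat.succ_mul, Nat.succ_mul, ← add_assoc] at hline
    by_cases h1 : redPt (shift d A g) E' i e 1 < dRes E (newtonSet A)
    · have h4 : dRes E (newtonSet A) * (s * dRes E (newtonSet A) + 1) ≤ dRes E (newtonSet A) *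
          ((dRes E (newtonSet A)).factorial * redPt (shift d A g) E' i e 0 + s * redPt (shift d A g) E' i e 1) :=
        Nat.mul_le_mul_left _ (by omega)
      rw [Nat.mul_succ] at h4
      omega
    · have h5 : s * dRes E (newtonSet A) ≤ s * redPt (shift d A g) E' i e 1 := Nat.mul_le_mul_left s (not_lt.1 h1)
      have h6 : dRes E (newtonSet A) * (s * dRes E (newtonSet A)) ≤ dRes E (newtonSet A) *
          ((dRes E (newtonSet A)).factorial * redPt (shift d A g) E' i e 0 + s * redPt (shift d A g) E' i e 1) :=
        Nat.mul_le_mul_left _ (by omega)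
      omega
  have hchain := le_trans hB (le_trans h513 (le_of_eq hW))
  rw [Nat.cast_le] at hchain
  omega

end Max

end WildMonic

end Summit.ResolutionOfSingularities.ResolutionOfSingularities.Theorems

end
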